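import Literature.MathematicalPhysics.QuantumLattice.InfVolFermionState
import HarnessLib

/-!
# The spin-exchange symmetry of infinite-volume lattice fermion states

Topic `MathematicalPhysics/QuantumLattice`. The Bogoliubov automorphism of the CAR algebra over
`ℤ^d × {↑,↓}` exchanging the two spin values, `Γ c_{xσ} Γ⁻¹ = c_{x σ̄}` (Bratteli–Robinson II Thm. 5.2.5;
on every local algebra `𝔄_Λ` it is the tree's `relabel Orb.spinSwap`), commutes with the isotony /
covariance maps `Γ(φ)` of the local algebras (`fermionEmbed_relabel_spinSwap`) and with the even–odd
automorphism `Θ` (`relabel_parityAut`). Precomposing a state with it gives the **spin-flipped state**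
`ω ∘ Γ` (`InfVolFermionState.spinFlip`), which is again translation invariant / even when `ω` is
(`IsTranslationInvariant.spinFlip`, `IsEven.spinFlip`), has the same particle density (`density_spinFlip`),
exchanged spin densities (`spinFlip_expect_nAt`), and — the Hubbard interaction being symmetric between
the up and the down spins (Lieb 1989; `relabel_spinSwap_hubbardΦ`) — the same Hubbard energy density
(`hubbardEnergyDensity_spinFlip`). Consumer: `HubbardSpinSymmetricStates.lean` (the spin-symmetrised
minimiser of the variational principle). Everything is PROVED; the only definition is the state
`spinFlip ω` (with body).

## References
* O. Bratteli, D. W. Robinson, *Operator Algebras and Quantum Statistical Mechanics II*, 2nd ed.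
  (Springer 1997), §5.2.2, Thm. 5.2.5 (Bogoliubov automorphisms of one-particle unitaries / bijections).
  [cite: BratteliRobinsonII1997, §5.2.2 Thm. 5.2.5]
* E. H. Lieb, *Two theorems on the Hubbard model*, Phys. Rev. Lett. 62 (1989) 1201, proof of Thm. 1
  ("the Hamiltonian is symmetric between the up and the down spins"). [cite: LiebPRL1989, proof of Theorem 1]
* H. Araki, H. Moriya, *Equilibrium statistical mechanics of fermion lattice systems*, Rev. Math. Phys.
  15 (2003) 93, §4.1 (states of the CAR algebra, `Θ`-even and `τ`-invariant states).
  [cite: ArakiMoriya2003, §4.1]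
-/

noncomputable section

namespace Literature.MathematicalPhysics.QuantumLattice

open Matrix Finset HubbardWave0 Literature.Probability.LatticeModels
open scoped ComplexOrder

variable {d : ℕ}

/-! ### The spin exchange commutes with isotony, translations and parity -/

section LocalFlip

variable {Λ Λ' : Type*} [LinearOrder Λ] [Fintype Λ] [LinearOrder Λ'] [Fintype Λ']

omit [LinearOrder Λ] [Fintype Λ] in
/-- Every orbital is `(x, σ)` for a site `x` and a spin `σ`. [cite: BratteliRobinsonII1997, §5.2.2 Thm. 5.2.5] -/
private theorem orb_ofLex_aux (i : Orb Λ) : orb (ofLex i).1 (ofLex i).2 = i := rfl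

/-- **The spin exchange commutes with the second quantisation of site injections**:
`Γ(φ) (Γ_swap a) = Γ_swap (Γ(φ) a)` (both are the unital `*`-homomorphisms with
`c_{xσ} ↦ c_{φ x, σ̄}`; uniqueness on the CAR generators). [cite: BratteliRobinsonII1997, §5.2.2 Thm. 5.2.5] -/
theorem fermionEmbed_relabel_spinSwap (φ : Λ ↪ Λ') (a : Matrix (Finset (Orb Λ)) (Finset (Orb Λ)) ℂ) :
    fermionEmbed φ (relabel (Orb.spinSwap : Orb Λ ≃ Orb Λ) a) =
      relabel (Orb.spinSwap : Orb Λ' ≃ Orb Λ') (fermionEmbed φ a) := by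
  have h : (fermionEmbed φ).comp ((relabel (Orb.spinSwap : Orb Λ ≃ Orb Λ)).toAlgHom) =
      ((relabel (Orb.spinSwap : Orb Λ' ≃ Orb Λ')).toAlgHom).comp (fermionEmbed φ) := by
    refine algHom_ext_car (fun i => ?_) (fun i => ?_)
    · rw [← orb_ofLex_aux i, AlgHom.comp_apply, AlgHom.comp_apply, AlgEquiv.toAlgHom_apply,
        AlgEquiv.toAlgHom_apply, relabel_annihilation, Orb.spinSwap_orb, fermionEmbed_annihilation,
        fermionEmbed_annihilation, relabel_annihilation, Orb.spinSwap_orb]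
    · rw [← orb_ofLex_aux i, AlgHom.comp_apply, AlgHom.comp_apply, AlgEquiv.toAlgHom_apply,
        AlgEquiv.toAlgHom_apply, relabel_creation, Orb.spinSwap_orb, fermionEmbed_creation,
        fermionEmbed_creation, relabel_creation, Orb.spinSwap_orb]
  have := congrArg (fun f : Matrix (Finset (Orb Λ)) (Finset (Orb Λ)) ℂ →ₐ[ℂ]
      Matrix (Finset (Orb Λ')) (Finset (Orb Λ')) ℂ => f a) h
  simpa only [AlgHom.comp_apply, AlgEquiv.toAlgHom_apply] using this

/-- **Relabellings commute with the even–odd automorphism**: `Γ_e (Θ a) = Θ (Γ_e a)` (both send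
`c_i ↦ -c_{e i}`). [cite: ArakiMoriya2003, §4.1 Def. 4.2] -/
theorem relabel_parityAut (e : Orb Λ ≃ Orb Λ') (a : Matrix (Finset (Orb Λ)) (Finset (Orb Λ)) ℂ) :
    relabel e (parityAut a) = parityAut (relabel e a) := by
  have h : ((relabel e).toAlgHom).comp (parityAut : _ →ₐ[ℂ] _) =
      (parityAut : _ →ₐ[ℂ] _).comp ((relabel e).toAlgHom) := by
    refine algHom_ext_car (fun i => ?_) (fun i => ?_)
    · rw [AlgHom.comp_apply, AlgHom.comp_apply, AlgEquiv.toAlgHom_apply, AlgEquiv.toAlgHom_apply,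
        parityAut_annihilation, map_neg, relabel_annihilation, parityAut_annihilation]
    · rw [AlgHom.comp_apply, AlgHom.comp_apply, AlgEquiv.toAlgHom_apply, AlgEquiv.toAlgHom_apply,
        parityAut_creation, map_neg, relabel_creation, parityAut_creation]
  have := congrArg (fun f : Matrix (Finset (Orb Λ)) (Finset (Orb Λ)) ℂ →ₐ[ℂ]
      Matrix (Finset (Orb Λ')) (Finset (Orb Λ')) ℂ => f a) h
  simpa only [AlgHom.comp_apply, AlgEquiv.toAlgHom_apply] using this

/-- The spin exchange is an involution on the local algebras: `Γ_swap (Γ_swap a) = a`. [cite: BratteliRobinsonII1997, §5.2.2 Thm. 5.2.5] -/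
theorem relabel_spinSwap_relabel_spinSwap (a : Matrix (Finset (Orb Λ)) (Finset (Orb Λ)) ℂ) :
    relabel (Orb.spinSwap : Orb Λ ≃ Orb Λ) (relabel (Orb.spinSwap : Orb Λ ≃ Orb Λ) a) = a := by
  have hswap : (Orb.spinSwap : Orb Λ ≃ Orb Λ).trans Orb.spinSwap = Equiv.refl _ :=
    Equiv.ext fun i => by
      rw [Equiv.trans_apply, Equiv.refl_apply, ← orb_ofLex_aux i, Orb.spinSwap_orb, Orb.spinSwap_orb,
        Equiv.swap_apply_self]
  rw [← relabel_trans, hswap, relabel_refl]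

end LocalFlip

/-! ### The spin-flipped state -/

namespace InfVolFermionState

variable (ω : InfVolFermionState d)

/-- **The spin-flipped state `ω ∘ Γ_swap`**: `(ω ∘ Γ)_Λ(A) = ω_Λ(Γ_swap A)` on every local algebra
(a state: `Γ_swap` is a unital `*`-automorphism commuting with isotony).
[cite: BratteliRobinsonII1997, §5.2.2 Thm. 5.2.5] -/
def spinFlip (ω : InfVolFermionState d) : InfVolFermionState d where
  expect Λ := ω.expect Λ ∘ₗ
    (relabel (Orb.spinSwap : Orb (PolySite Λ) ≃ Orb (PolySite Λ))).toLinearMap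
  expect_one Λ := by
    rw [LinearMap.comp_apply, AlgEquiv.toLinearMap_apply, map_one, ω.expect_one]
  expect_nonneg Λ A := by
    rw [LinearMap.comp_apply, AlgEquiv.toLinearMap_apply, map_mul, relabel_conjTranspose]
    exact ω.expect_nonneg _ _
  compatible Λ Λ' h A := by
    rw [LinearMap.comp_apply, AlgEquiv.toLinearMap_apply, LinearMap.comp_apply,
      AlgEquiv.toLinearMap_apply, ← fermionEmbed_relabel_spinSwap, ω.compatible h]

/-- The local expectations of the spin-flipped state (definitional unfolding).
[cite: BratteliRobinsonII1997, §5.2.2 Thm. 5.2.5] -/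
theorem spinFlip_expect (Λ : Finset (Site d)) (A : FermionOp Λ) :
    ω.spinFlip.expect Λ A = ω.expect Λ (relabel (Orb.spinSwap : Orb (PolySite Λ) ≃ Orb (PolySite Λ)) A) :=
  rfl

/-- Flipping twice gives back the state. [cite: ArakiMoriya2003, §4.1] -/
theorem spinFlip_spinFlip : ω.spinFlip.spinFlip = ω := by
  refine InfVolFermionState.ext fun Λ => LinearMap.ext fun A => ?_
  rw [spinFlip_expect, spinFlip_expect, relabel_spinSwap_relabel_spinSwap]

/-- **Spin flip commutes with translations**: `(ω ∘ Γ) ∘ τ_v = (ω ∘ τ_v) ∘ Γ`. [cite: ArakiMoriya2003, §4.1] -/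
theorem spinFlip_shift (v : Site d) : ω.spinFlip.shift v = (ω.shift v).spinFlip := by
  refine InfVolFermionState.ext fun Λ => LinearMap.ext fun A => ?_
  rw [shift_expect, spinFlip_expect, spinFlip_expect, shift_expect, fermionEmbed_relabel_spinSwap]

/-- **The spin-flipped state of a translation-invariant state is translation invariant.**
[cite: ArakiMoriya2003, §4.1 Def. 4.5] -/
theorem IsTranslationInvariant.spinFlip {ω : InfVolFermionState d} (hω : ω.IsTranslationInvariant) :
    ω.spinFlip.IsTranslationInvariant := fun v => by
  rw [spinFlip_shift, hω v]

/-- **The spin-flipped state of an even state is even.** [cite: ArakiMoriya2003, §4.1 Def. 4.5] -/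
theorem IsEven.spinFlip {ω : InfVolFermionState d} (hω : ω.IsEven) : ω.spinFlip.IsEven := fun Λ A => by
  rw [spinFlip_expect, spinFlip_expect, relabel_parityAut, hω]

/-- `Γ_swap n_{xσ} = n_{x σ̄}` on a region. [cite: BratteliRobinsonII1997, §5.2.2 Thm. 5.2.5] -/
theorem relabel_spinSwap_nAt {Λ : Finset (Site d)} (x : Site d) (hx : x ∈ Λ) (σ : Fin 2) :
    relabel (Orb.spinSwap : Orb (PolySite Λ) ≃ Orb (PolySite Λ)) (nAt x hx σ) =
      nAt x hx (Equiv.swap (0 : Fin 2) 1 σ) := by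
  rw [nAt, nAt, numberOp, numberOp, map_mul, relabel_creation, relabel_annihilation, Orb.spinSwap_orb]

/-- `Γ_swap c_{xσ} = c_{x σ̄}` on a region. [cite: BratteliRobinsonII1997, §5.2.2 Thm. 5.2.5] -/
theorem relabel_spinSwap_cAt {Λ : Finset (Site d)} (x : Site d) (hx : x ∈ Λ) (σ : Fin 2) :
    relabel (Orb.spinSwap : Orb (PolySite Λ) ≃ Orb (PolySite Λ)) (cAt x hx σ) =
      cAt x hx (Equiv.swap (0 : Fin 2) 1 σ) := by
  rw [cAt, cAt, relabel_annihilation, Orb.spinSwap_orb]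

/-- **The spin densities are exchanged**: `(ω ∘ Γ)(n_{xσ}) = ω(n_{x σ̄})`. [cite: ArakiMoriya2003, §4.1] -/
theorem spinFlip_expect_nAt {Λ : Finset (Site d)} (x : Site d) (hx : x ∈ Λ) (σ : Fin 2) :
    ω.spinFlip.expect Λ (nAt x hx σ) = ω.expect Λ (nAt x hx (Equiv.swap (0 : Fin 2) 1 σ)) := by
  rw [spinFlip_expect, relabel_spinSwap_nAt]

/-- **The particle density is unchanged**: `ρ_{ω∘Γ}(x) = ρ_ω(x)`. [cite: ArakiMoriya2003, §4.1] -/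
theorem densityAt_spinFlip (x : Site d) : ω.spinFlip.densityAt x = ω.densityAt x := by
  rw [densityAt, densityAt, map_add, map_add, spinFlip_expect_nAt, spinFlip_expect_nAt,
    Equiv.swap_apply_left, Equiv.swap_apply_right, add_comm]

/-- `ρ_{ω∘Γ} = ρ_ω`. [cite: ArakiMoriya2003, §4.1] -/
theorem density_spinFlip : ω.spinFlip.density = ω.density :=
  ω.densityAt_spinFlip 0

/-! ### The Hubbard interaction is symmetric between the spins -/

/-- **The local Hubbard terms are spin-exchange invariant**: `Γ_swap Φ(X) = Φ(X)` (`n_↑ n_↓ ↦ n_↓ n_↑`,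
the hopping term is summed over the spins). [cite: LiebPRL1989, proof of Theorem 1] -/
theorem relabel_spinSwap_hubbardΦ (t U : ℝ) (X : Finset (Site d)) :
    relabel (Orb.spinSwap : Orb (PolySite X) ≃ Orb (PolySite X)) ((hubbardFermionInteraction d t U).Φ X) =
      (hubbardFermionInteraction d t U).Φ X := by
  have hn : ∀ (x : Site d) (hx : x ∈ X),
      relabel (Orb.spinSwap : Orb (PolySite X) ≃ Orb (PolySite X)) (nAt x hx 0 * nAt x hx 1) =
        nAt x hx 0 * nAt x hx 1 := by
    intro x hx
    rw [map_mul, relabel_spinSwap_nAt, relabel_spinSwap_nAt, Equiv.swap_apply_left, Equiv.swap_apply_right,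
      nAt, nAt, ← numberAt_orb, ← numberAt_orb, (numberAt_commute _ _).eq]
  have hc : ∀ (x y : Site d) (hx : x ∈ X) (hy : y ∈ X),
      relabel (Orb.spinSwap : Orb (PolySite X) ≃ Orb (PolySite X))
          (∑ σ : Fin 2, ((cAt x hx σ)ᴴ * cAt y hy σ + (cAt y hy σ)ᴴ * cAt x hx σ)) =
        ∑ σ : Fin 2, ((cAt x hx σ)ᴴ * cAt y hy σ + (cAt y hy σ)ᴴ * cAt x hx σ) := by
    intro x y hx hy
    rw [map_sum]
    simp only [map_add, map_mul, relabel_conjTranspose, relabel_spinSwap_cAt]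
    rw [Fin.sum_univ_two, Fin.sum_univ_two, Equiv.swap_apply_left, Equiv.swap_apply_right, add_comm]
  simp only [hubbardFermionInteraction, map_add, map_sum, apply_ite (relabel (Orb.spinSwap :
    Orb (PolySite X) ≃ Orb (PolySite X))), map_zero, map_smul, hn, hc]

/-- **The Hubbard mean-energy observable is spin-exchange invariant.** [cite: LiebPRL1989, proof of Theorem 1] -/
theorem relabel_spinSwap_hubbard_meanEnergyObs (t U R : ℝ) :
    relabel (Orb.spinSwap : Orb (PolySite (thicken ({0} : Finset (Site d)) R)) ≃ _)
        ((hubbardFermionInteraction d t U).meanEnergyObs R) =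
      (hubbardFermionInteraction d t U).meanEnergyObs R := by
  rw [FermionInteraction.meanEnergyObs, map_sum]
  refine Finset.sum_congr rfl fun X _ => ?_
  rw [map_smul, ← fermionEmbed_relabel_spinSwap, relabel_spinSwap_hubbardΦ]

/-- **The Hubbard energy density is unchanged by the spin flip**: `e(ω ∘ Γ) = e(ω)`.
[cite: LiebPRL1989, proof of Theorem 1] -/
theorem hubbardEnergyDensity_spinFlip (t U : ℝ) :
    ω.spinFlip.hubbardEnergyDensity t U = ω.hubbardEnergyDensity t U := by
  rw [InfVolFermionState.hubbardEnergyDensity, InfVolFermionState.hubbardEnergyDensity, meanEnergy,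
    meanEnergy, spinFlip_expect, relabel_spinSwap_hubbard_meanEnergyObs]

end InfVolFermionState

end Literature.MathematicalPhysics.QuantumLattice

end
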